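import Literature.NumberTheory.LFunctions.DeBruijnNewmanUpperBound
import HarnessLib

/-!
# Polymath 15: the effective approximation `H_t ≈ B_t f_t` (Thm. 1.3) and the Table 1 numerics

Trunk T-ANT (`Literature/NumberTheory/LFunctions`); second companion of
`DeBruijnNewmanUpperBound.lean`. That file reduced Platt–Trudgian's `Λ ≤ 0.2`
(`Literature.NumberTheory.LFunctions.platt_trudgian`) to two certified computations, the second
being the named fact `Literature.NumberTheory.LFunctions.Polymath15.table1_row2` (= hypotheses
(ii) "asymptotic zero-free region at time `t₀`" and (iii) "barrier" of Polymath 15, Thm. 1.2, for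
`X = 5·10¹² + 194858`, `t₀ = 0.186`, `y₀ = 0.16733`; Polymath 15, §10, Table 1, row 2). This file
vendors the objects and the analytic theorem through which Polymath 15 verifies such hypotheses,
and records precisely which parts of row 2 are computation.

## Contents

* **The objects of Polymath 15, §1** (definitions, eqs. (M-def)–(N-def-main) of the arXiv source =
  the displayed formulas between Thm. 1.2 and Thm. 1.3): the Stirling-type factor `M₀`
  (`Polymath15.M₀`), its logarithmic derivative `α` (`Polymath15.alpha`), the deformation
  `M_t = exp(t α²/4) M₀` (`Polymath15.Mt`), `s₊ = (1 + y − ix)/2`, `s₋ = (1 − y + ix)/2`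
  (`sPlus`, `sMinus`), the normaliser `B_t(x + iy) = M_t(s₊)` (`Bt`), the coefficients
  `b_n^t = exp(t log² n / 4)` (`bCoeff`), `γ`, `s_*`, `κ` (`gamma`, `sStar`, `kappa`), the
  Riemann–Siegel length `N = ⌊√(x/4π + t/16)⌋` (`rsN`) and the main term `f_t(x + iy)` (`ft`);
  the printed majorants of the error terms, `errAB` (for `e_A + e_B`) and `errC0` (for `e_{C,0}`),
  and the region `EffRegion` (`0 < t ≤ 1/2`, `0 ≤ y ≤ 1`, `x ≥ 200`; eq. (1.6)/(region)).
* **Thm. 1.3** ("effective Riemann–Siegel approximation"), as NAMED FACTS: the approximation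
  `|H_t(x+iy)/B_t(x+iy) − f_t(x+iy)| ≤ errAB + errC0` (`effective_approximation`: the printed
  `H_t/B_t = f_t + O_≤(e_A + e_B + e_{C,0})` combined with the printed bounds for `e_A + e_B` and
  `e_{C,0}`; the intermediate quantities `e_A, e_B, e_{C,0}` of §6, eqs. (ea-def)–(ec-def), which
  involve the auxiliary `ε_{t,n}`, `ε̃` of Props. 6.1, 6.3, are eliminated and NOT defined here),
  and the three parameter bounds `gamma_bound`, `re_sStar_bound`, `kappa_bound`.
* **Cor. 1.4** ("criterion for non-vanishing"), PROVED from `effective_approximation`: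
  `deBruijnH_ne_zero_of_err_lt`; also `M₀_ne_zero`, `Mt_ne_zero`, `Bt_ne_zero`.
* **How (ii) and (iii) are reached** (§8.2–8.4, general parameters, PROVED):
  `finalZeroFree_of_err_lt` (hypothesis (ii) from the pointwise criterion Cor. 1.4 along `t = t₀`,
  the form used for `N ≥ N₁` in §8.3) and `barrierZeroFree_of_box` (hypothesis (iii) from the
  absence of zeros in the simpler box `X ≤ x ≤ X + 1`, `y₀ ≤ y ≤ 1`, `0 ≤ t ≤ t₀` in which the
  barrier computations were actually run, §1 and §8.2).
* **Table 1, row 2, split** : the barrier half as run, `table1_row2_barrier_box` (NAMED FACT,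
  certified computation: winding number `0` on every rectangle, §10), and
  `table1_row2_of_barrier_box` (PROVED): `FinalZeroFree 0.186 X 0.16733 → table1_row2_barrier_box →
  table1_row2`. The (ii)-half is kept verbatim as the hypothesis `FinalZeroFree 0.186 X 0.16733`;
  its printed evidence is discussed at `table1_row2_of_barrier_box`.

## What is NOT here

The proofs of Thm. 1.3 (§4–§6: heat-flow representation, Riemann–Siegel expansion of `H₀` after
Arias de Reyna, saddle-point shifts, Props. 6.1–6.6) — an honest multi-session formalisation
target, hence the named facts; the `A + B − C` refinement (Cor. 6.4, `e_C`); Thm. 1.5 (§9); the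
multiple-evaluation scheme of §7 and the derivative bounds of Lemma 8.4; and the numerics
themselves (barrier meshes at `x ≈ 5·10¹²` with `N = 630783`-term sums to 20 digits; Euler-mollified
lower bounds for `N₀ ≤ N ≤ N₁`), which are certified computations outside the reach of kernel
evaluation. The elementary summation lemmas of the method (Lemma 8.2, Lemma 10.1) are proved in
`Polymath15SummationLemmas.lean`.

## References

* D. H. J. Polymath, *Effective approximation of heat flow evolution of the Riemann `ξ` function,
  and a new upper bound for the de Bruijn–Newman constant*, Res. Math. Sci. 6 (2019), Paper 31
  (arXiv:1904.12438): §1 (eqs. before Thm. 1.3), Thm. 1.3, Cor. 1.4, §6.5 (Prop. 6.6), §8.2–8.4,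
  §10 and Table 1.
* D. J. Platt, T. S. Trudgian, *The Riemann hypothesis is true up to `3·10¹²`*, Bull. Lond. Math.
  Soc. 53 (2021) 792–797, §3.4, Cor. 2.
-/

noncomputable section

open Complex

open scoped Real

namespace Literature.NumberTheory.LFunctions

namespace Polymath15

/-! ## The objects of Polymath 15, §1 -/

/-- The Stirling-type factor
`M₀(s) = (1/8) · (s(s − 1)/2) · π^{−s/2} · √(2π) · exp((s/2 − 1/2) Log(s/2) − s/2)`
("the Stirling approximation to the factor `(1/8)(s(s−1)/2) π^{−s/2} Γ(s/2)`"), with the standard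
branch `Log` and the standard power `π^{−s/2} = exp(−(s/2) log π)` (Mathlib's `cpow`; §2 of the
source: `z^w := exp(w Log z)`). Defined for all `s` (the source restricts to `ℂ ∖ (−∞, 1]`).
[cite: Polymath2019, §1, definition of M₀ before Thm. 1.3] -/
def M₀ (s : ℂ) : ℂ :=
  1 / 8 * (s * (s - 1) / 2) * (π : ℂ) ^ (-s / 2) * (Real.sqrt (2 * π) : ℂ) *
    Complex.exp ((s / 2 - 1 / 2) * Complex.log (s / 2) - s / 2)

/-- The logarithmic derivative `α = M₀'/M₀` in its printed closed form
`α(s) = 1/(2s) + 1/(s − 1) + (1/2) Log(s/(2π))`.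
[cite: Polymath2019, §1, formula for α before Thm. 1.3] -/
def alpha (s : ℂ) : ℂ :=
  1 / (2 * s) + 1 / (s - 1) + 1 / 2 * Complex.log (s / (2 * π))

/-- The time-`t` deformation `M_t(s) = exp((t/4) α(s)²) M₀(s)`.
[cite: Polymath2019, §1, definition of M_t before Thm. 1.3] -/
def Mt (t : ℝ) (s : ℂ) : ℂ :=
  Complex.exp (t / 4 * alpha s ^ 2) * M₀ s

/-- `s₊ = s₊(x + iy) = (1 + y − ix)/2` (Cor. 6.4; the argument of `M_t` in `B_t`, `s_*`).
[cite: Polymath2019, Cor. 6.4] -/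
def sPlus (x y : ℝ) : ℂ := (1 + y - x * I) / 2

/-- `s₋ = s₋(x + iy) = (1 − y + ix)/2` (Cor. 6.4; the numerator argument in `γ`).
[cite: Polymath2019, Cor. 6.4] -/
def sMinus (x y : ℝ) : ℂ := (1 - y + x * I) / 2

/-- The normaliser `B_t(x + iy) = M_t((1 + y − ix)/2)`, "basically a variant of the Gamma
factor, that removes the exponential decay of `H_t`".
[cite: Polymath2019, §1, definition of B_t before Thm. 1.3] -/
def Bt (t x y : ℝ) : ℂ := Mt t (sPlus x y)

/-- The coefficients `b_n^t = exp((t/4) log² n)` of Thm. 1.3. [cite: Polymath2019, Thm. 1.3] -/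
def bCoeff (t : ℝ) (n : ℕ) : ℝ := Real.exp (t / 4 * Real.log n ^ 2)

/-- `γ = γ(x + iy) = M_t((1 − y + ix)/2) / M_t((1 + y − ix)/2)` of Thm. 1.3.
[cite: Polymath2019, Thm. 1.3] -/
def gamma (t x y : ℝ) : ℂ := Mt t (sMinus x y) / Mt t (sPlus x y)

/-- `s_* = s_*(x + iy) = (1 + y − ix)/2 + (t/2) α((1 + y − ix)/2)` of Thm. 1.3.
[cite: Polymath2019, Thm. 1.3] -/
def sStar (t x y : ℝ) : ℂ := sPlus x y + t / 2 * alpha (sPlus x y)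

/-- `κ = κ(x + iy) = (t/2) (α((1 − y + ix)/2) − α((1 + y + ix)/2))` of Thm. 1.3.
[cite: Polymath2019, Thm. 1.3] -/
def kappa (t x y : ℝ) : ℂ := t / 2 * (alpha (sMinus x y) - alpha ((1 + y + x * I) / 2))

/-- The Riemann–Siegel length `N = ⌊√(x/(4π) + t/16)⌋` of Thm. 1.3 (a natural number; the
argument of the floor is nonnegative for `x ≥ 0`, `t ≥ 0`). [cite: Polymath2019, Thm. 1.3] -/
def rsN (t x : ℝ) : ℕ := ⌊Real.sqrt (x / (4 * π) + t / 16)⌋₊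

/-- The main term of Thm. 1.3,
`f_t(x + iy) = ∑_{n=1}^N b_n^t / n^{s_*} + γ ∑_{n=1}^N n^y b_n^t / n^{conj(s_*) + κ}`
(complex powers `n^w = exp(w log n)`, Mathlib's `cpow`; `n^y` the real power). It is holomorphic
in `x + iy` where `N` is constant and jumps when `N` increments. [cite: Polymath2019, Thm. 1.3] -/
def ft (t x y : ℝ) : ℂ :=
  ∑ n ∈ Finset.Icc 1 (rsN t x), (bCoeff t n : ℂ) / (n : ℂ) ^ sStar t x y +
    gamma t x y * ∑ n ∈ Finset.Icc 1 (rsN t x),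
      (((n : ℝ) ^ y : ℝ) : ℂ) * (bCoeff t n : ℂ) /
        (n : ℂ) ^ (starRingEnd ℂ (sStar t x y) + kappa t x y)

/-- The printed majorant of `e_A + e_B` in Thm. 1.3:
`∑_{n=1}^N (1 + |γ| N^{|κ|} n^y) (b_n^t / n^{Re s_*}) (exp(δ_n) − 1)` with
`δ_n = ((t²/16) log²(x/(4πn²)) + 0.626)/(x − 6.66)`.
[cite: Polymath2019, Thm. 1.3, bound for e_A + e_B] -/
def errAB (t x y : ℝ) : ℝ :=
  ∑ n ∈ Finset.Icc 1 (rsN t x),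
    (1 + ‖gamma t x y‖ * (rsN t x : ℝ) ^ ‖kappa t x y‖ * (n : ℝ) ^ y) *
      (bCoeff t n / (n : ℝ) ^ (sStar t x y).re) *
        (Real.exp ((t ^ 2 / 16 * Real.log (x / (4 * π * (n : ℝ) ^ 2)) ^ 2 + 0.626) / (x - 6.66)) -
          1)

/-- The printed majorant of `e_{C,0}` in Thm. 1.3:
`(x/4π)^{−(1+y)/4} exp(−(t/16) log²(x/4π) + 1.24 (3^y + 3^{−y})/(N − 0.125)
  + (3 |log(x/4π) + iπ/2| + 10.44)/(x − 12))`.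
[cite: Polymath2019, Thm. 1.3, bound for e_{C,0}] -/
def errC0 (t x y : ℝ) : ℝ :=
  (x / (4 * π)) ^ (-(1 + y) / 4) *
    Real.exp (-(t / 16) * Real.log (x / (4 * π)) ^ 2 +
      1.24 * ((3 : ℝ) ^ y + (3 : ℝ) ^ (-y)) / ((rsN t x : ℝ) - 0.125) +
        (3 * ‖(Real.log (x / (4 * π)) : ℂ) + π / 2 * I‖ + 10.44) / (x - 12))

/-- The region (1.6) of Polymath 15 in which Thm. 1.3 is stated:
`0 < t ≤ 1/2`, `0 ≤ y ≤ 1`, `x ≥ 200`. [cite: Polymath2019, §1, eq. (region) before Thm. 1.3] -/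
def EffRegion (t x y : ℝ) : Prop :=
  0 < t ∧ t ≤ 1 / 2 ∧ 0 ≤ y ∧ y ≤ 1 ∧ 200 ≤ x

/-! ## Theorem 1.3 (named facts) and Corollary 1.4 (proved) -/

/-- NAMED FACT (Polymath 15, **Thm. 1.3**, effective Riemann–Siegel approximation to
`H_t(x + iy)`, in the combined form "approximation + printed error majorants"). For `t, x, y` in
the region (1.6) (`EffRegion`): `H_t(x+iy)/B_t(x+iy) = f_t(x+iy) + O_≤(e_A + e_B + e_{C,0})` with
`e_A + e_B ≤ errAB t x y` and `e_{C,0} ≤ errC0 t x y`; hence, as stated here,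
`‖H_t(x+iy)/B_t(x+iy) − f_t(x+iy)‖ ≤ errAB t x y + errC0 t x y`. (`H_t` = `deBruijnH t`, same
normalisation, eq. (1.2) of the source.) Printed proof: §4 (heat flow applied to a Riemann–Siegel
type expansion of `H₀`), §6 (Props. 6.1–6.3, Cors. 6.4–6.5, Prop. 6.6 (iv)–(vi)).
[cite: Polymath2019, Thm. 1.3] -/
def effective_approximation : Prop :=
  ∀ t x y : ℝ, EffRegion t x y →
    ‖deBruijnH t (x + y * I) / Bt t x y - ft t x y‖ ≤ errAB t x y + errC0 t x y

/-- NAMED FACT (Polymath 15, **Thm. 1.3**, the bound for `γ`; Prop. 6.6 (i)): in the region (1.6),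
`|γ| ≤ e^{0.02 y} (x/4π)^{−y/2}`. [cite: Polymath2019, Thm. 1.3] -/
def gamma_bound : Prop :=
  ∀ t x y : ℝ, EffRegion t x y → ‖gamma t x y‖ ≤ Real.exp (0.02 * y) * (x / (4 * π)) ^ (-y / 2)

/-- NAMED FACT (Polymath 15, **Thm. 1.3**, the bound for `Re s_*`, as printed in Thm. 1.3): in the
region (1.6), `Re s_* ≥ (1+y)/2 + (t/4) log(x/4π) − (t/(2x²)) (1 − 3y + 4y(1+y)/x²)_+`.
(Prop. 6.6 (ii) prints the last bracket as `(1 − 3y + 8y(1−y)/x²)_+`; we vendor the statement of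
Thm. 1.3. Both corrections are `< 10⁻²³` in the applications, §8.2.)
[cite: Polymath2019, Thm. 1.3] -/
def re_sStar_bound : Prop :=
  ∀ t x y : ℝ, EffRegion t x y →
    (1 + y) / 2 + t / 4 * Real.log (x / (4 * π)) -
        t / (2 * x ^ 2) * max (1 - 3 * y + 4 * y * (1 + y) / x ^ 2) 0 ≤ (sStar t x y).re

/-- NAMED FACT (Polymath 15, **Thm. 1.3**, the bound for `κ`; Prop. 6.6 (iii)): in the region
(1.6), `|κ| ≤ t y / (2 (x − 6))`. [cite: Polymath2019, Thm. 1.3] -/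
def kappa_bound : Prop :=
  ∀ t x y : ℝ, EffRegion t x y → ‖kappa t x y‖ ≤ t * y / (2 * (x - 6))

/-- **Polymath 15, Cor. 1.4** ("criterion for non-vanishing"), proved from Thm. 1.3: in the region
(1.6), if `|f_t(x + iy)| > e_A + e_B + e_{C,0}` — here, `>` the printed majorant
`errAB + errC0` — then `H_t(x + iy) ≠ 0` ("from (1.8) and the triangle inequality").
[cite: Polymath2019, Cor. 1.4] -/
theorem deBruijnH_ne_zero_of_err_lt (h : effective_approximation) {t x y : ℝ} (hr : EffRegion t x y)
    (hlt : errAB t x y + errC0 t x y < ‖ft t x y‖) : deBruijnH t (x + y * I) ≠ 0 := by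
  intro h0
  have := h t x y hr
  rw [h0, zero_div, zero_sub, norm_neg] at this
  exact absurd (this.trans_lt hlt) (lt_irrefl _)

/-- `M₀(s) ≠ 0` for `s ≠ 0, 1` (`M₀ : ℂ ∖ (−∞,1] → ℂ ∖ {0}` in the source): a product of non-zero
factors. [cite: Polymath2019, §1] -/
theorem M₀_ne_zero {s : ℂ} (h0 : s ≠ 0) (h1 : s ≠ 1) : M₀ s ≠ 0 := by
  have hπ : (π : ℂ) ≠ 0 := by exact_mod_cast Real.pi_ne_zero
  have hsq : (Real.sqrt (2 * π) : ℂ) ≠ 0 := by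
    exact_mod_cast (Real.sqrt_pos.2 (by positivity)).ne'
  simp only [M₀]
  refine mul_ne_zero (mul_ne_zero (mul_ne_zero (mul_ne_zero (by norm_num) ?_) ?_) hsq)
    (Complex.exp_ne_zero _)
  · exact div_ne_zero (mul_ne_zero h0 (sub_ne_zero.2 h1)) two_ne_zero
  · rw [Ne, Complex.cpow_eq_zero_iff, not_and_or]
    exact Or.inl hπ

/-- `M_t(s) ≠ 0` for `s ≠ 0, 1`. [cite: Polymath2019, §1] -/
theorem Mt_ne_zero (t : ℝ) {s : ℂ} (h0 : s ≠ 0) (h1 : s ≠ 1) : Mt t s ≠ 0 :=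
  mul_ne_zero (Complex.exp_ne_zero _) (M₀_ne_zero h0 h1)

/-- "`B_t(x + iy)` is non-vanishing": here for `x ≠ 0` (then `s₊ ≠ 0, 1`), which covers the
region (1.6). [cite: Polymath2019, §1] -/
theorem Bt_ne_zero (t : ℝ) {x : ℝ} (hx : x ≠ 0) (y : ℝ) : Bt t x y ≠ 0 := by
  refine Mt_ne_zero t ?_ ?_ <;> intro h <;> apply hx
  · simpa [sPlus] using congrArg Complex.im h
  · simpa [sPlus] using congrArg Complex.im h

/-! ## From the numerics to hypotheses (ii) and (iii) of Theorem 1.2 -/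

/-- Hypothesis (ii) of Thm. 1.2 (`FinalZeroFree t₀ X y₀`) from the pointwise criterion Cor. 1.4
at time `t₀` on the region `x ≥ X + √(1 − y₀²)`, `y₀ ≤ y ≤ √(1 − 2t₀)` (which lies in (1.6) when
`0 < t₀ ≤ 1/2`, `y₀ ≥ 0`, `X ≥ 200`) — the form in which (ii) is verified for `N ≥ N₁` in §8.3
("By Proposition 8.1, it suffices to establish the bound `|f_t(x+iy)| > 1.25 × 10⁻³`").
[cite: Polymath2019, §8.2–8.3] -/
theorem finalZeroFree_of_err_lt (h : effective_approximation) {t₀ X y₀ : ℝ} (ht₀ : 0 < t₀)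
    (ht : t₀ ≤ 1 / 2) (hy₀ : 0 ≤ y₀) (hX : 200 ≤ X)
    (hpt : ∀ x y : ℝ, X + Real.sqrt (1 - y₀ ^ 2) ≤ x → y₀ ≤ y → y ≤ Real.sqrt (1 - 2 * t₀) →
      errAB t₀ x y + errC0 t₀ x y < ‖ft t₀ x y‖) :
    FinalZeroFree t₀ X y₀ := by
  intro x y hx hy hy'
  refine deBruijnH_ne_zero_of_err_lt h ⟨ht₀, ht, hy₀.trans hy, ?_, ?_⟩ (hpt x y hx hy hy')
  · exact hy'.trans (Real.sqrt_le_one.2 (by linarith))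
  · exact hX.trans ((le_add_of_nonneg_right (Real.sqrt_nonneg _)).trans hx)

/-- Hypothesis (iii) of Thm. 1.2 (`BarrierZeroFree t₀ X y₀`, the curved barrier
`X ≤ x ≤ X + √(1 − y₀²)`, `√(y₀² + 2(t₀ − t)) ≤ y ≤ √(1 − 2t)`, `0 ≤ t ≤ t₀`) from the absence of
zeros of `H_t` in the box `X ≤ x ≤ X + 1`, `y₀ ≤ y ≤ 1`, `0 ≤ t ≤ t₀` (for `0 ≤ y₀`): "In practice,
we have found it convenient numerically to replace the barrier region in Theorem 1.2 with the
larger and simpler region `X ≤ x ≤ X+1; y₀ ≤ y ≤ 1; 0 ≤ t ≤ t₀`" (§1, after Thm. 1.2; §8.2,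
region (a)). [cite: Polymath2019, §1 and §8.2] -/
theorem barrierZeroFree_of_box {t₀ X y₀ : ℝ} (hy₀ : 0 ≤ y₀)
    (h : ∀ t x y : ℝ, 0 ≤ t → t ≤ t₀ → X ≤ x → x ≤ X + 1 → y₀ ≤ y → y ≤ 1 →
      deBruijnH t (x + y * I) ≠ 0) :
    BarrierZeroFree t₀ X y₀ := by
  intro t x y ht ht' hx hx' hy hy'
  have h1 : Real.sqrt (1 - y₀ ^ 2) ≤ 1 := Real.sqrt_le_one.2 (by nlinarith)
  refine h t x y ht ht' hx (by linarith) (le_trans ?_ hy) (hy'.trans ?_)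
  · calc y₀ = Real.sqrt (y₀ ^ 2) := (Real.sqrt_sq hy₀).symm
      _ ≤ Real.sqrt (y₀ ^ 2 + 2 * (t₀ - t)) := Real.sqrt_le_sqrt (by linarith)
  · exact Real.sqrt_le_one.2 (by linarith)

/-! ## Table 1, row 2: the barrier computation as run, and the split of `table1_row2` -/

/-- NAMED FACT (certified computation; Polymath 15, §10, Table 1 "Conditional `Λ` Results", row 2:
`X = 5·10¹² + 194858`, `t₀ = 0.186`, `y₀ = 0.16733`, `Λ = 0.20`, Winding Number `0`,
`N₀ = 630783`). The barrier half of the row in the form in which it was computed: `H_t(x + iy)`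
has no zeros in the box `X ≤ x ≤ X + 1`, `y₀ ≤ y ≤ 1`, `0 ≤ t ≤ t₀` (the enlarged barrier of §1
and §8.2 (a); there `N = N₀ = 630783` is constant and `f_t` holomorphic). Evidence as printed
(§10): "All barrier runs generated a winding number of zero for each rectangle and the scripts
completed successfully without any errors. For all barrier locations, the computations of the
mesh points where calculated at 20 digits accuracy except for the highest two" (rows 11–12);
method of §8.4 (Rouché on `∂R` per time step, mesh spacing from the derivative bounds of
Lemma 8.4, multiple evaluation by the Taylor scheme of §7, error allowance from Prop. 8.1-type
bounds via Thm. 1.3). Implies hypothesis (iii) for row 2 (`barrierZeroFree_of_box`).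
[cite: Polymath2019, §10, Table 1 (row 2)] -/
def table1_row2_barrier_box : Prop :=
  ∀ t x y : ℝ, 0 ≤ t → t ≤ 0.186 → 5 * 10 ^ 12 + 194858 ≤ x → x ≤ 5 * 10 ^ 12 + 194858 + 1 →
    0.16733 ≤ y → y ≤ 1 → deBruijnH t (x + y * I) ≠ 0

/-- Hypothesis (iii) of Thm. 1.2 for the parameters of Table 1, row 2, from the box computation.
[cite: Polymath2019, §10, Table 1 (row 2)] -/
theorem barrierZeroFree_table1_row2 (h : table1_row2_barrier_box) :
    BarrierZeroFree 0.186 (5 * 10 ^ 12 + 194858) 0.16733 :=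
  barrierZeroFree_of_box (by norm_num) h

/-- **`table1_row2` split into its two halves as they stand in print.** The barrier half (iii) is
the certified computation `table1_row2_barrier_box`. The half (ii) (`FinalZeroFree 0.186 X 0.16733`:
no zeros of `H_{0.186}(x + iy)` with `x ≥ X + √(1 − y₀²)`, `y₀ ≤ y ≤ √0.628`) is kept verbatim as
a hypothesis: for it Table 1 prints `N₀ = 630783` and the lower bound `|f_{t₀}(x + iy₀)| ≥ 0.0376`
at `N = N₀` (obtained with Lemma 10.1), while of its extension to all `N ≥ N₀` by the method of
§8.3/§8.5 (Lemma 8.2, Euler mollifiers on `N`-intervals, the argument principle on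
`{y₀ ≤ y ≤ 1, N₀ ≤ N ≤ N₁}`) §10 says the authors "expect to be able to verify the hypothesis …
for any choice of parameters `t₀, y₀, N₀` as above"; Platt–Trudgian 2021, §3.4, read row 2 as
establishing `Λ ≤ 0.2` given RH to height `X/2` (their Cor. 2). When (ii) is obtained pointwise
from Thm. 1.3, use `finalZeroFree_of_err_lt`.
[cite: Polymath2019, §10, Table 1 (row 2)] [cite: PlattTrudgianBLMS2021, §3.4] -/
theorem table1_row2_of_barrier_box (hii : FinalZeroFree 0.186 (5 * 10 ^ 12 + 194858) 0.16733)
    (hbox : table1_row2_barrier_box) : table1_row2 :=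
  ⟨hii, barrierZeroFree_table1_row2 hbox⟩

/-- The same with (ii) supplied through Thm. 1.3 and a pointwise lower bound for `|f_{0.186}|`
beating the printed error majorant on the region (ii) of row 2.
[cite: Polymath2019, §8.2–8.3 and §10, Table 1 (row 2)] -/
theorem table1_row2_of_err_lt (h : effective_approximation)
    (hpt : ∀ x y : ℝ, 5 * 10 ^ 12 + 194858 + Real.sqrt (1 - 0.16733 ^ 2) ≤ x → 0.16733 ≤ y →
      y ≤ Real.sqrt (1 - 2 * 0.186) → errAB 0.186 x y + errC0 0.186 x y < ‖ft 0.186 x y‖)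
    (hbox : table1_row2_barrier_box) : table1_row2 :=
  table1_row2_of_barrier_box
    (finalZeroFree_of_err_lt h (by norm_num) (by norm_num) (by norm_num) (by norm_num) hpt) hbox

end Polymath15

end Literature.NumberTheory.LFunctions

end
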